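import Literature.NumberTheory.EllipticCurves.ModularCurve
import Literature.NumberTheory.EllipticCurves.GlobalMinimalModel
import Literature.NumberTheory.EllipticCurves.GaloisAction
import Mathlib.NumberTheory.LegendreSymbol.JacobiSymbol
import HarnessLib
import HarnessLib.Audit.Tags

/-!
# Candidates E-es-18 / E-es-19 / E-es-20 (residual piece) at the prime `3`: the SHIFT-TWIST certificate
# `KatoShiftTwistManinThree`, the shift-class generation law `ShiftClassGenerationThree`, and the reducible
# residual `ManinPrimeToThreeOfReducible` — cell `bsd-f2-manin` (D-0131 (3) frontier: the Manin constant at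
# additive primes). `@[conjecture]` leaf (NOTHING asserted; definitions only; proved edges live in the sibling
# `KatoShiftThreeLawsEdges.lean`).

HONEST FRAMING. LENS = Euler systems / explicit reciprocity (planner `bsd-f2-manin-es` g6, HOME
`run/shared/lean/pub/bsd-f2-manin/MEMO-es.md` §18 «POLAR INVISIBILITY»; Line file
HOME/es/Line-es-kato-shift-three.lean sha16 1048ba04918db19b, farm rc 0 · 4 sorries = its 4 registered stubs,
audited copy HOME/ref1-C41-es-g6.lean 950403ad1cbe8d5f). Props VERBATIM from that file with its helper notions
INLINED so that this leaf declares nothing but `@[conjecture]` defs: the lattice clause `IsLatticeOptimal D` ↦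
`∀ z ∈ D.L.lattice, ∃ w ∈ periodLattice D.f, z = D.c * w`; `primeClass f ℓ a` ↦ `{0, a/ℓ}_f =
modularSymbol f (a/ℓ) − modularSymbol f 0`; `shiftClass f ℓ a` ↦ `{0,3a/ℓ}_f − {0,a/ℓ}_f`; `shiftClassSpan f S`
↦ `AddSubgroup.closure {shift classes, ℓ ∈ S, 0 < a < ℓ}`; `epsSign W q` ↦ `if (q·a_q) % 3 = 1 then −1 else 1`;
`AdmissiblePrime W N ℓ` ↦ `ℓ` prime, `ℓ ∤ N`, `ℓ ≡ 11 (mod 12)`, `(q/ℓ) = epsSign W q` at every `q ∥ N` (the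
sibling Edges file re-declares these abbreviations by name and proves the `Iff.rfl` bridge).

THE ROWS. **E-es-18 `KatoShiftTwistManinThree`** (LAW on the irreducible locus, K4-free AND
Kosters–Pannekoek-free): `X₀(N)`-lattice-optimal `W`, `9 ∣ N`, `W[3]` irreducible ⟹ `3 ∤ c`. MECHANISM (memo
§18, kernel-checked composition `katoShiftTwistManinThree_of` in the Line file, with the additive glue
`additive_of_nine_dvd_level` and the punchline `functional_nonvanishing_gen` PROVED there): the `p = 3` Kato
fact in Néron units with the character-side receptacle condition `χ(3) ∉ {±1}` (tree named fact
`Literature.NumberTheory.EllipticCurves.kato_neron_isIntegral_twistedSymbolSum_of_additive_three_polar`, derived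
reading) at every odd `χ` modulo an admissible prime `ℓ` ⟹ orthogonality with a hole at `⟨3⟩ ≤ (ℤ/ℓ)^×`:
under `3 ∣ c` every shift class `{a/ℓ, 3a/ℓ}_f` is `3`-divisible in lattice units (memo §18.3) ⟹ with
E-es-19 the primitive functional `Im/(Ω⁻_f/2)` vanishes mod `3` on `mΛ_f`, `3 ∤ m` — absurd. **E-es-19
`ShiftClassGenerationThree`** (the ONE new input; f-level form of the Line's `stub_shiftClass_generation`):
for `ρ̄_{W,3}` irreducible and `9 ∣ N`, the shift classes over admissible `ℓ ≥ ℓ₀` span a subgroup of `Λ_f` of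
index prime to `3` (f-free form: the annihilator in `H¹(X₀(N),𝔽₃)` of ALL shift classes is the Eisenstein
DIAMOND span, `dim = #{q ∣ N : q ≡ 1 (3)} + [27 ∣ N]` — an Ihara-type statement for the diagonal `A₃` at a
prime whose square divides the level). **E-es-20, residual piece `ManinPrimeToThreeOfReducible`**: the
complement of E-es-18's locus inside crux C3 `ManinPrimeToThreeAtNine` (stmt-BirchSwinnertonDyer-22968) —
`W[3]` REDUCIBLE, `9 ∣ N`, lattice-optimal ⟹ `3 ∤ c` — typed so that the split «C3 ⟸ E-es-18 ∧ residual» is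
a by-name edge (Edges file); not a lens law, not attacked by the Euler-system lever (Kato's lattice transfer
needs irreducibility; Wuthrich 2014 Thm. 4 repairs it only at semistable `p`).

NOT IN PRINT (cell refuter-2, HOME/REFUTER-ref2.md finding 55, LIT-PLACEMENT v7 §L⁷ 1942b0b5d5cc710e): E-es-18
is a theorem MODULO the derived-reading fact (print-corollary grade) and E-es-19; E-es-19 is NOT IN PRINT — the
printed Ihara lemmas at a prime dividing the level (Wiles 1995 Lemma 2.5 = Darmon–Diamond–Taylor 1995 Lemma
4.28(b)) read «`ℓ` an odd prime different from `p`», Diamond–Ribet treat `p = ℓ` only for `m_ℓ ≤ 1`, and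
multiplicity one mod `3` fails at `9 ∣ N` (Agashe–Ribet–Stein 2012 Prop. 2.3) so no Gorenstein argument
applies; nearest «shape» citations below are NOT sources of the statements.

BC5 WITNESS (cell census = the witness of record). E-es-18: HOME/es/E18A-SHIFT3-curves-v1.tsv 61d756e17693f8eb
+ E18C (kit j291736 + j292072; summary E18AC-SHIFT3-combined-v1.summary.txt 3a0b6f38ffb9fbb8) · optimal curves
with `9 ∣ N ≤ 5000` · 4313/4313 (3473 irreducible: K–P classes never 1318 / Q9 1186 / always 969; 840
reducible) have an admissible prime `ℓ ≤ 683` at which `y_f` is shift-sharp · all `c = 1` (Cremona) ·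
beyond-print rows 0 · violations 0. E-es-19: HOME/es/E18B-SHIFT3-levels-v1.tsv 1a40491e51294edf (kit j291737 +
j291809 + j292086) · all 76 levels `N = 9k`, `27 ≤ N ≤ 702` · 76/76 six-fold equality dim Ann(shift classes,
`ℓ ≤ 400`) = dim Ann_Hecke = #Eisenstein lines = dia_pred = dia_realised = dia ∩ Ann; restricted to `ℓ ≡ 11
(12)`: 76/76 · violations 0 (refuter-1 note: E18B tests the f-free annihilator over ALL `ℓ ≡ 2 (3)` up to the
bound, the typed stub uses ADMISSIBLE `ℓ ≥ ℓ₀`; bridge = prime-class generation at level `3N`, provable).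
Residual: 840/4313 curves, all `c = 1`. Cheapest falsifiers RUN (memo §18.7 (a)–(d)): none bit.
REFUTER VERDICTS: REF1 **SURVIVE** 2026-08-27T22:31:11Z (HOME/REFUTER-ref1.md §R34 5016b5ea4466de7a: E-es-18
SURVIVES-typed = theorem modulo F-es-18 ∧ E-es-19, composition kernel-checked, axioms standard, `hpos`
load-bearing and discharged; E-es-19 SURVIVES as CONJECTURE, not in print; E-es-20 split kernel-checked BY
NAME against the route decl); REF2 (v7 §L⁷): placement as above; novelty of E-es-19 as a statement NEW.
-/

noncomputable section

open scoped BigOperators MatrixGroups ModularForm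

open CongruenceSubgroup WeierstrassCurve
  Literature.NumberTheory.EllipticCurves Literature.NumberTheory.EllipticCurves.ModularForms

namespace Summit.BirchSwinnertonDyer.Rank1Residual.ManinAdditive

/-- **Candidate E-es-18 `KatoShiftTwistManinThree` (cell bsd-f2-manin; LAW on the `W[3]`-irreducible locus,
no Kosters–Pannekoek hypothesis, nothing asserted):** for every globally minimal `W/ℚ`, every level `N` with
`9 ∣ N` and every `X₀(N)`-parametrisation datum `D` of `W` with the lattice clause `Λ_W = c·Λ_f` (optimal
parametrisation), if `W[3]` is irreducible then `3 ∤ c`. VERBATIM the Line file's `KatoShiftTwistManinThree`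
(HOME/es/Line-es-kato-shift-three.lean 1048ba04918db19b §4) with `IsLatticeOptimal` inlined. A theorem MODULO
the tree's derived-reading fact `kato_neron_isIntegral_twistedSymbolSum_of_additive_three_polar` and
`ShiftClassGenerationThree` below (composition kernel-checked in the Line file; refuter-1 §R34).
[cite: Kato2004Asterisque, (8.1.3) (p. 180) and Thm. 12.5 (p. 222) (shape only: the zeta-element integrality that drives the
lever — the Manin statement at additive 3 is NOT in print, cell bsd-f2-manin MEMO-es.md §18, row E-es-18)] -/
@[conjecture] def KatoShiftTwistManinThree : Prop :=
  ∀ (W : WeierstrassCurve ℚ) [W.IsElliptic] [W.IsGloballyMinimal] {N : ℕ} [NeZero N]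
    (D : ModularParametrizationData W N),
    (∀ z ∈ D.L.lattice, ∃ w ∈ periodLattice D.f, z = D.c * w) → 3 ^ 2 ∣ N →
    W.HasIrreducibleModPGaloisRep 3 → ¬ (3 : ℤ) ∣ D.c

/-- **Candidate E-es-19 `ShiftClassGenerationThree` (cell bsd-f2-manin; the ONE new input of the `p = 3`
certificate — an Ihara-type generation law for the shift `A₃ = diag(3,1)` at levels with `9 ∣ N`; NOT in print;
nothing asserted):** for `W/ℚ` with newform `f` of level `N`, `9 ∣ N`, `W[3]` irreducible, and any `ℓ₀`, there
is `m` with `3 ∤ m` such that `m·Λ_f` lies in the subgroup of `ℂ` generated by the SHIFT CLASSES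
`{a/ℓ, 3a/ℓ}_f = ({0,3a/ℓ}_f) − ({0,a/ℓ}_f)`, `0 < a < ℓ`, over the ADMISSIBLE primes `ℓ ≥ ℓ₀` (`ℓ ∤ N` prime,
`ℓ ≡ 11 (mod 12)`, `(q/ℓ) = ε_q(W)` at every `q ∥ N`, `ε_q = −1` if `q·a_q ≡ 1 (mod 3)` else `+1`). VERBATIM
the Line file's `stub_shiftClass_generation` statement (1048ba04918db19b §3) with `shiftClassSpan`,
`shiftClass`, `primeClass`, `AdmissiblePrime`, `epsSign` inlined (the Edges file proves the by-name `Iff`).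
f-free form behind it (memo §18.4, data 76/76 levels): the annihilator of all shift classes in
`H¹(X₀(N), 𝔽₃)` is exactly the Eisenstein diamond span.
[cite: DarmonDiamondTaylor1995, Lemma 4.28 (shape only: Ihara's lemma at a prime dividing the level reads «ℓ ≠ p» there and in
Wiles 1995 Lemma 2.5 — the diagonal statement at 3² ∣ N is NOT in print, cell bsd-f2-manin MEMO-es.md §18.4 / REFUTER-ref2
finding 55, row E-es-19)] -/
@[conjecture] def ShiftClassGenerationThree : Prop :=
  ∀ (W : WeierstrassCurve ℚ) [W.IsElliptic] {N : ℕ} [NeZero N] (f : CuspForm (Gamma0 N) 2) (ℓ₀ : ℕ),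
    IsNewformOf W f → 3 ^ 2 ∣ N → W.HasIrreducibleModPGaloisRep 3 →
    ∃ m : ℕ, ¬ 3 ∣ m ∧ ∀ z ∈ periodLattice f,
      (m : ℂ) * z ∈ AddSubgroup.closure
        {z : ℂ | ∃ ℓ ∈ {ℓ : ℕ | ℓ₀ ≤ ℓ ∧ (ℓ.Prime ∧ ¬ ℓ ∣ N ∧ ℓ % 12 = 11 ∧
            ∀ q ∈ N.primeFactors, ¬ q ^ 2 ∣ N →
              jacobiSym (q : ℤ) ℓ = (if ((q : ℤ) * W.LFunction q) % 3 = 1 then -1 else 1))},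
          ∃ a : ℕ, 0 < a ∧ a < ℓ ∧
            z = (modularSymbol f (((3 * a : ℕ) : ℚ) / ℓ) - modularSymbol f 0) -
                (modularSymbol f ((a : ℚ) / ℓ) - modularSymbol f 0)}

/-- **Candidate E-es-20, residual piece `ManinPrimeToThreeOfReducible` (cell bsd-f2-manin; the REDUCIBLE
RESIDUAL of crux C3 `ManinPrimeToThreeAtNine`, stmt-BirchSwinnertonDyer-22968 — not a lens law, not attacked by
the Euler-system lever; nothing asserted):** for every globally minimal `W/ℚ`, every level `N` with `9 ∣ N` and
every `X₀(N)`-datum `D` of `W` with the lattice clause, if `W[3]` is REDUCIBLE then `3 ∤ c`. VERBATIM the Line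
file's `stub_reducible_residual` statement (1048ba04918db19b §3), `IsLatticeOptimal` inlined; C3's fact-free
body is `KatoShiftTwistManinThree ∧ ManinPrimeToThreeOfReducible` by cases on irreducibility (Edges file,
by name). Census: 840 of the 4313 optimal curves with `9 ∣ N ≤ 5000`, all with `c = 1`.
[cite: Wuthrich2014, Thm. 4 (shape only: lattice integrality is repaired under reducibility at SEMISTABLE primes only — the
additive-3 Manin statement on the 3-isogeny locus is NOT in print, cell bsd-f2-manin MEMO-es.md §18.5, row E-es-20)] -/
@[conjecture] def ManinPrimeToThreeOfReducible : Prop :=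
  ∀ (W : WeierstrassCurve ℚ) [W.IsElliptic] [W.IsGloballyMinimal] {N : ℕ} [NeZero N]
    (D : ModularParametrizationData W N),
    (∀ z ∈ D.L.lattice, ∃ w ∈ periodLattice D.f, z = D.c * w) → 3 ^ 2 ∣ N →
    ¬ W.HasIrreducibleModPGaloisRep 3 → ¬ (3 : ℤ) ∣ D.c

end Summit.BirchSwinnertonDyer.Rank1Residual.ManinAdditive

end
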